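import Literature.MathematicalPhysics.QuantumFieldTheory.Balaban1983to89.B8Thm2TorusLetters

/-!
# `Balaban1983to89.B8TorusPeriodization` — the PERIODISATION `π` through the fundamental box of the torus `T_η` read on `ℤᵈ`
# (sub-row «G-B8-T2S», RULING #4 v3, layer 0 of `lit-balaban-t2s-1/g2/V3-DESIGN.md`)

statement-level skeleton of published theorems with citation tags; proofs where landed; nothing here is a claim about the
Yang–Mills mass gap

T. Bałaban, *Spaces of regular gauge field configurations …*, Commun. Math. Phys. **99** (1985) 75–102 `[Balaban1985RegularSpaces]`: p. 77 («Ω_j =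
T_η»; the torus of side `P` read as `P`-periodic data on `ℤᵈ`), (1.3)–(1.6) p. 77 (the `j`-th lattice `T^{(j)}` of the torus has side `P∕Lʲ`).
T. Bałaban, *Propagators for lattice gauge theories in a background field*, Commun. Math. Phys. **99** (1985) 389–434
`[Balaban1985BackgroundPropagators]`: §3 (operators on `T_η`).  STATUS: published, refereed.

CITATION HEADER (lean-in-tree rule).  Cell `lit-balaban`, seat `lit-balaban-t2s-1` (gen 2).  WHY: the v3 letter bundle `B8Thm2TorusLettersPer.LettersAtPer`
states [4]'s laws at `P`-PERIODIC arguments only; the Prop.-5 engines of the tree (`B8LambdaSpaceKLevel.fixedPoint_kLevel` → `B8SectE*` → `B8SockHFP*`)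
take the BOUND laws at ALL arguments.  The bridge is the periodisation `π`: `(πf)(x) = f(x mod P)` coordinatewise (level families: `x mod P∕Lʲ` at
level `j`) — `ℂ`-linear, the identity on periodic arguments, with periodic values, never increasing a sup-type norm; precomposing a letter with `π`
turns a law at periodic arguments into a law at all arguments (layer 2, the converter).  This file is the elementary layer 0: `pmod`, `perz`,
`perzFam`, the `XSpace` version `perzX` (a `compContinuous`), and their laws.  Elementary bookkeeping about `ℤᵈ`; nothing of [B8]∕[4] is proved;
count-neutral; nothing continuum ∕ ℝ⁴ ∕ OS ∕ mass-gap ∕ Clay.  No `sorry`, no `… : Prop` fact, no `instance`, no `notation`.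
-/

noncomputable section

open scoped BigOperators

namespace Literature.MathematicalPhysics.QuantumFieldTheory.Balaban1983to89.B8TorusPeriodization

open B7Prop1Explicit
open B8Eq1117Concrete (XSpace)
open B8Prop5ContractionKLevel (Bd2)
open B8LambdaSpaceKLevel (wt)

-- `Site` alone could resolve to the torus sites of `Setup.lean`; re-export the `ℤ^d` sites of `B7Prop1Explicit`.
export B7Prop1Explicit (Site)

variable {d : ℕ}

/-! ## §1 Reduction modulo `P` and periodic site functions -/

section Pmod

/-- **Coordinatewise reduction modulo `P`**: `(x mod P)_i = x_i mod P` (for `P = 0` the identity). The representative of `x` in the fundamental box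
`[0, P)ᵈ` of the torus of side `P` read on `ℤᵈ`. [cite: Balaban1985RegularSpaces, p.77 («Ω_j = T_η»)] -/
def pmod (P : ℤ) (x : Site d) : Site d := fun i => x i % P

/-- unfolding. [cite: Balaban1985RegularSpaces, p.77] -/
@[simp] theorem pmod_apply (P : ℤ) (x : Site d) (i : Fin d) : pmod P x i = x i % P := rfl

/-- A translate by a multiple of `P•e_i` has the same reduction. [cite: Balaban1985RegularSpaces, p.77] -/
theorem pmod_add_zsmul_e (P : ℤ) (x : Site d) (i : Fin d) (n : ℤ) : pmod P (x + (n * P) • e i) = pmod P x := by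
  funext j
  simp only [pmod_apply, Pi.add_apply, Pi.smul_apply, e, Pi.single_apply, smul_eq_mul]
  split_ifs with h
  · rw [mul_one, Int.add_mul_emod_self_right]
  · rw [mul_zero, add_zero]

/-- In particular for `P•e_i` itself. [cite: Balaban1985RegularSpaces, p.77] -/
theorem pmod_add_smul_e (P : ℤ) (x : Site d) (i : Fin d) : pmod P (x + P • e i) = pmod P x := by
  simpa only [one_mul] using pmod_add_zsmul_e P x i 1

/-- `x mod P = x + Σ_i (−(x_i ∕ P)·P)•e_i`. [cite: Balaban1985RegularSpaces, p.77] -/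
theorem pmod_eq_add_sum (P : ℤ) (x : Site d) : pmod P x = x + ∑ i : Fin d, ((-(x i / P)) * P) • (e i : Site d) := by
  funext j
  simp only [pmod_apply, Pi.add_apply, Finset.sum_apply, Pi.smul_apply, e, Pi.single_apply, smul_eq_mul, mul_ite, mul_one,
    mul_zero, Finset.sum_ite_eq, Finset.mem_univ, if_true]
  rw [Int.emod_def]; ring

variable {β : Type*}

/-- **A `P`-periodic site function is invariant under every multiple of `P•e_i`.** [cite: Balaban1985RegularSpaces, p.77 («Ω_j = T_η»)] -/
theorem apply_add_zsmul_of_per {P : ℤ} {f : Site d → β} (hf : ∀ (z : Site d) (i : Fin d), f (z + P • e i) = f z) (x : Site d) (i : Fin d)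
    (n : ℤ) : f (x + (n * P) • e i) = f x := by
  induction n using Int.induction_on generalizing x with
  | zero => simp
  | succ n ih =>
      have h1 : x + ((↑n + 1) * P) • (e i : Site d) = (x + (↑n * P) • e i) + P • e i := by
        rw [add_mul, one_mul, add_smul, add_assoc]
      rw [h1, hf, ih]
  | pred n ih =>
      have h1 : (x + ((-↑n - 1) * P) • (e i : Site d)) + P • e i = x + ((-↑n) * P) • e i := by
        rw [sub_mul, one_mul, sub_smul, add_assoc, sub_add_cancel]
      rw [← ih x, ← h1, hf]

/-- … and under every integer combination `Σ_{i ∈ s} (n_i P)•e_i`. [cite: Balaban1985RegularSpaces, p.77] -/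
theorem apply_add_sum_of_per {P : ℤ} {f : Site d → β} (hf : ∀ (z : Site d) (i : Fin d), f (z + P • e i) = f z) (x : Site d) (n : Fin d → ℤ)
    (s : Finset (Fin d)) : f (x + ∑ i ∈ s, (n i * P) • (e i : Site d)) = f x := by
  induction s using Finset.induction_on generalizing x with
  | empty => simp
  | insert i s hi ih => rw [Finset.sum_insert hi, add_comm ((n i * P) • (e i : Site d)), ← add_assoc, apply_add_zsmul_of_per hf, ih]

/-- **A `P`-periodic site function factors through the fundamental box: `f (x mod P) = f x`.** [cite: Balaban1985RegularSpaces, p.77 («Ω_j = T_η»)] -/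
theorem apply_pmod_of_per {P : ℤ} {f : Site d → β} (hf : ∀ (z : Site d) (i : Fin d), f (z + P • e i) = f z) (x : Site d) :
    f (pmod P x) = f x := by
  rw [pmod_eq_add_sum]
  exact apply_add_sum_of_per hf x (fun i => -(x i / P)) Finset.univ

end Pmod

/-! ## §2 The periodisation `π` of site functions and of level families -/

section Perz

variable {β : Type*}

/-- **The periodisation `π_P f := f ∘ (· mod P)`** of a site function. [cite: Balaban1985RegularSpaces, p.77 («Ω_j = T_η»)] -/
def perz (P : ℤ) (f : Site d → β) : Site d → β := fun x => f (pmod P x)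

/-- unfolding. [cite: Balaban1985RegularSpaces, p.77] -/
@[simp] theorem perz_apply (P : ℤ) (f : Site d → β) (x : Site d) : perz P f x = f (pmod P x) := rfl

/-- `π_P f` is `P`-periodic, for EVERY `f`. [cite: Balaban1985RegularSpaces, p.77] -/
theorem perz_per (P : ℤ) (f : Site d → β) : ∀ (z : Site d) (i : Fin d), perz P f (z + P • e i) = perz P f z := fun z i => by
  rw [perz_apply, perz_apply, pmod_add_smul_e]

/-- `π_P f = f` for `P`-periodic `f`. [cite: Balaban1985RegularSpaces, p.77] -/
theorem perz_eq_self_of_per {P : ℤ} {f : Site d → β} (hf : ∀ (z : Site d) (i : Fin d), f (z + P • e i) = f z) : perz P f = f :=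
  funext fun x => apply_pmod_of_per hf x

/-- **The periodisation of a level family at truncation `n`: level `j ≤ n` is reduced modulo `P∕Lʲ`, levels above `n` are untouched** (the
`j`-th lattice of the torus of side `P` has side `P∕Lʲ`; a truncation-`n` letter reads the levels `j ≤ n` only).
[cite: Balaban1985RegularSpaces, (1.3)–(1.6) p.77] -/
def perzFam (L : ℕ) (P : ℤ) (n : ℕ) (μ : ℕ → Site d → β) : ℕ → Site d → β :=
  fun j => if j ≤ n then perz (P / (L : ℤ) ^ j) (μ j) else μ j

/-- unfolding at a level `j ≤ n`. [cite: Balaban1985RegularSpaces, p.77] -/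
theorem perzFam_apply_of_le (L : ℕ) (P : ℤ) {n : ℕ} (μ : ℕ → Site d → β) {j : ℕ} (hj : j ≤ n) (y : Site d) :
    perzFam L P n μ j y = μ j (pmod (P / (L : ℤ) ^ j) y) := by
  simp [perzFam, hj]

/-- unfolding at a level `j > n`. [cite: Balaban1985RegularSpaces, p.77] -/
theorem perzFam_apply_of_not_le (L : ℕ) (P : ℤ) {n : ℕ} (μ : ℕ → Site d → β) {j : ℕ} (hj : ¬ j ≤ n) :
    perzFam L P n μ j = μ j := by
  simp [perzFam, hj]

/-- `π μ` is level-periodic at every level `j ≤ n`, for EVERY family `μ`. [cite: Balaban1985RegularSpaces, p.77] -/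
theorem perzFam_per (L : ℕ) (P : ℤ) (n : ℕ) (μ : ℕ → Site d → β) :
    ∀ j, j ≤ n → ∀ (y : Site d) (i : Fin d), perzFam L P n μ j (y + (P / (L : ℤ) ^ j) • e i) = perzFam L P n μ j y :=
  fun j hj y i => by rw [perzFam_apply_of_le L P μ hj, perzFam_apply_of_le L P μ hj, pmod_add_smul_e]

/-- `π μ = μ` for a family that is level-periodic at every level `j ≤ n`. [cite: Balaban1985RegularSpaces, p.77] -/
theorem perzFam_eq_self_of_per {L : ℕ} {P : ℤ} {n : ℕ} {μ : ℕ → Site d → β}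
    (hμ : ∀ j, j ≤ n → ∀ (y : Site d) (i : Fin d), μ j (y + (P / (L : ℤ) ^ j) • e i) = μ j y) : perzFam L P n μ = μ := by
  funext j y
  by_cases hj : j ≤ n
  · rw [perzFam_apply_of_le L P μ hj]; exact apply_pmod_of_per (hμ j hj) y
  · rw [perzFam_apply_of_not_le L P μ hj]

end Perz

/-! ## §3 Linearity, norms, self-adjointness -/

section LinearMaps

variable {𝔸 : Type*} [NormedRing 𝔸] [NormedAlgebra ℂ 𝔸]

/-- **`π_P` as a `ℂ`-linear map of site functions** (precomposition). [cite: Balaban1985RegularSpaces, p.77] -/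
def perzₗ (P : ℤ) : (Site d → 𝔸) →ₗ[ℂ] (Site d → 𝔸) := LinearMap.funLeft ℂ 𝔸 (pmod P)

/-- unfolding. [cite: Balaban1985RegularSpaces, p.77] -/
@[simp] theorem perzₗ_apply (P : ℤ) (f : Site d → 𝔸) : perzₗ (d := d) P f = perz P f := rfl

/-- **The periodisation of level families (truncation `n`) as a `ℂ`-linear map.** [cite: Balaban1985RegularSpaces, p.77] -/
def perzFamₗ (L : ℕ) (P : ℤ) (n : ℕ) : (ℕ → Site d → 𝔸) →ₗ[ℂ] (ℕ → Site d → 𝔸) where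
  toFun := perzFam L P n
  map_add' μ ν := by
    funext j y
    by_cases hj : j ≤ n
    · simp only [perzFam_apply_of_le L P _ hj, Pi.add_apply]
    · simp only [perzFam_apply_of_not_le L P _ hj, Pi.add_apply]
  map_smul' c μ := by
    funext j y
    by_cases hj : j ≤ n
    · simp only [perzFam_apply_of_le L P _ hj, Pi.smul_apply, RingHom.id_apply]
    · simp only [perzFam_apply_of_not_le L P _ hj, Pi.smul_apply, RingHom.id_apply]

/-- unfolding. [cite: Balaban1985RegularSpaces, p.77] -/
@[simp] theorem perzFamₗ_apply (L : ℕ) (P : ℤ) (n : ℕ) (μ : ℕ → Site d → 𝔸) : perzFamₗ (d := d) L P n μ = perzFam L P n μ := rfl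

end LinearMaps

section Norms

variable {𝔸 : Type*} [NormedRing 𝔸]

/-- `π` never increases a pointwise bound. [cite: Balaban1985RegularSpaces, p.86 (the sup norms)] -/
theorem norm_perz_le {P : ℤ} {f : Site d → 𝔸} {C : ℝ} (h : ∀ x, ‖f x‖ ≤ C) : ∀ x, ‖perz P f x‖ ≤ C := fun _ => h _

/-- `π` never increases the `(−2)`-weighted size `|·|₍₋₂₎` on `Ω_j = ℤᵈ` (the weights do not depend on the site). [cite: Balaban1985RegularSpaces, p.86 (after (1.55)), (1.98) p.92] -/
theorem bd2_perz {L k : ℕ} {η : ℝ} {P : ℤ} {f : Site d → 𝔸} {m : ℝ} (h : Bd2 L η k (fun _ => (Set.univ : Set (Site d))) f m) :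
    Bd2 L η k (fun _ => (Set.univ : Set (Site d))) (perz P f) m :=
  fun j hj x _ => h j hj (pmod P x) (Set.mem_univ _)

/-- `π − 1` costs at most twice the `(−2)`-weighted size. [cite: Balaban1985RegularSpaces, p.86, (1.98) p.92] -/
theorem bd2_sub_perz {L k : ℕ} {η : ℝ} {P : ℤ} {f : Site d → 𝔸} {m : ℝ} (h : Bd2 L η k (fun _ => (Set.univ : Set (Site d))) f m) :
    Bd2 L η k (fun _ => (Set.univ : Set (Site d))) (f - perz P f) (2 * m) := by
  intro j hj x hx
  rw [Pi.sub_apply]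
  have h1 := h j hj x hx
  have h2 := h j hj (pmod P x) (Set.mem_univ _)
  have hw : 0 ≤ wt L η j ^ 2 := sq_nonneg _
  calc wt L η j ^ 2 * ‖f x - f (pmod P x)‖ ≤ wt L η j ^ 2 * (‖f x‖ + ‖f (pmod P x)‖) :=
        mul_le_mul_of_nonneg_left (norm_sub_le _ _) hw
    _ ≤ 2 * m := by rw [mul_add]; linarith

/-- `π` preserves pointwise self-adjointness. [cite: Balaban1985RegularSpaces, p.93 (real configurations)] -/
theorem isSelfAdjoint_perz [StarRing 𝔸] {P : ℤ} {f : Site d → 𝔸} (h : ∀ x, IsSelfAdjoint (f x)) : ∀ x, IsSelfAdjoint (perz P f x) :=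
  fun _ => h _

/-- `π` commutes with `−star` pointwise. [cite: Balaban1985RegularSpaces, p.93] -/
theorem perz_neg_star [StarRing 𝔸] (P : ℤ) (f : Site d → 𝔸) : perz P (fun x => -star (f x)) = fun x => -star (perz P f x) := rfl

/-- `π` preserves the vanishing of a linear functional pointwise (`τ`-freeness). [cite: Balaban1985RegularSpaces, p.76] -/
theorem apply_perz_eq_zero [NormedAlgebra ℂ 𝔸] (τ : 𝔸 →L[ℂ] ℂ) {P : ℤ} {f : Site d → 𝔸} (h : ∀ x, τ (f x) = 0) :
    ∀ x, τ (perz P f x) = 0 := fun _ => h _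

end Norms

/-! ## §4 The periodisation on `XSpace` (bounded families indexed by `Fin (n+1) × ℤᵈ`) -/

section XSpacePerz

variable {𝔸 : Type*} [NormedRing 𝔸] [NormedAlgebra ℂ 𝔸]

/-- The index map `(j, y) ↦ (j, y mod P∕Lʲ)` (continuous: discrete index). [cite: Balaban1985RegularSpaces, (1.3)–(1.6) p.77] -/
def pmodIdx (L : ℕ) (P : ℤ) (n : ℕ) : C(Fin (n + 1) × Site d, Fin (n + 1) × Site d) :=
  ⟨fun p => (p.1, pmod (P / (L : ℤ) ^ (p.1 : ℕ)) p.2), continuous_of_discreteTopology⟩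

/-- unfolding. [cite: Balaban1985RegularSpaces, p.77] -/
@[simp] theorem pmodIdx_apply (L : ℕ) (P : ℤ) (n : ℕ) (p : Fin (n + 1) × Site d) :
    pmodIdx (d := d) L P n p = (p.1, pmod (P / (L : ℤ) ^ (p.1 : ℕ)) p.2) := rfl

/-- **The periodisation of an `XSpace` family** (`compContinuous` with the index map), a `ℂ`-linear self-map. [cite: Balaban1985RegularSpaces, (1.91)–(1.92) p.91, p.77] -/
def perzX (L : ℕ) (P : ℤ) (n : ℕ) : XSpace d n 𝔸 →ₗ[ℂ] XSpace d n 𝔸 where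
  toFun X := X.compContinuous (pmodIdx L P n)
  map_add' X Y := by ext p; rfl
  map_smul' c X := by ext p; rfl

/-- unfolding. [cite: Balaban1985RegularSpaces, p.77] -/
@[simp] theorem perzX_apply (L : ℕ) (P : ℤ) (n : ℕ) (X : XSpace d n 𝔸) (p : Fin (n + 1) × Site d) :
    perzX (d := d) L P n X p = X (p.1, pmod (P / (L : ℤ) ^ (p.1 : ℕ)) p.2) := rfl

/-- `‖πX‖ ≤ ‖X‖`. [cite: Balaban1985RegularSpaces, (1.92) p.91] -/
theorem norm_perzX_le (L : ℕ) (P : ℤ) (n : ℕ) (X : XSpace d n 𝔸) : ‖perzX (d := d) L P n X‖ ≤ ‖X‖ :=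
  BoundedContinuousFunction.norm_compContinuous_le _ _

/-- `πX` is level-periodic, for EVERY `X`. [cite: Balaban1985RegularSpaces, p.77] -/
theorem perzX_per (L : ℕ) (P : ℤ) (n : ℕ) (X : XSpace d n 𝔸) :
    ∀ (p : Fin (n + 1) × Site d) (i : Fin d),
      perzX (d := d) L P n X (p.1, p.2 + (P / (L : ℤ) ^ (p.1 : ℕ)) • e i) = perzX (d := d) L P n X p := fun p i => by
  rw [perzX_apply, perzX_apply, pmod_add_smul_e]

/-- `πX = X` for level-periodic `X`. [cite: Balaban1985RegularSpaces, p.77] -/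
theorem perzX_eq_self_of_per {L : ℕ} {P : ℤ} {n : ℕ} {X : XSpace d n 𝔸}
    (hX : ∀ (p : Fin (n + 1) × Site d) (i : Fin d), X (p.1, p.2 + (P / (L : ℤ) ^ (p.1 : ℕ)) • e i) = X p) :
    perzX (d := d) L P n X = X := by
  ext p
  rw [perzX_apply]
  have hX' : ∀ (z : Site d) (i : Fin d), (fun y => X (p.1, y)) (z + (P / (L : ℤ) ^ (p.1 : ℕ)) • e i) = (fun y => X (p.1, y)) z :=
    fun z i => by simpa using hX (p.1, z) i
  exact apply_pmod_of_per (P := P / (L : ℤ) ^ (p.1 : ℕ)) (f := fun y => X (p.1, y)) hX' p.2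

/-- `πX` commutes with `−star` pointwise. [cite: Balaban1985RegularSpaces, p.93] -/
theorem perzX_neg_star [StarRing 𝔸] {L : ℕ} {P : ℤ} {n : ℕ} {X Y : XSpace d n 𝔸} (h : ∀ p, Y p = -star (X p)) :
    ∀ p, perzX (d := d) L P n Y p = -star (perzX (d := d) L P n X p) := fun p => by
  rw [perzX_apply, perzX_apply, h]

/-- `πX` preserves the vanishing of a linear functional pointwise. [cite: Balaban1985RegularSpaces, p.76] -/
theorem apply_perzX_eq_zero (τ : 𝔸 →L[ℂ] ℂ) {L : ℕ} {P : ℤ} {n : ℕ} {X : XSpace d n 𝔸} (h : ∀ p, τ (X p) = 0) :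
    ∀ p, τ (perzX (d := d) L P n X p) = 0 := fun p => by rw [perzX_apply]; exact h _

end XSpacePerz

end Literature.MathematicalPhysics.QuantumFieldTheory.Balaban1983to89.B8TorusPeriodization

end
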